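import Summits.CriticalPhenomena.CardyFormulaZ2.Theorems.CardyUSTContinuationKirchhoffExtremalLengthG02MissingEdge
import Summits.CriticalPhenomena.CardyFormulaZ2.Theorems.CardyUSTContinuationKirchhoffExtremalLengthG02NoCircuit

/-!
# Boundary values of the potential of `Ω_δ` near interior points of the Dirichlet arcs
# ([GP19] Lemma 4.8 for the `meshDomain` / `discreteArc` discretisation, via weak Beurling)

Support file for `KirchhoffExtremalLength` (route CardyUSTContinuation of `CardyFormulaZ2`, item
stmt-CriticalPhenomena-11234), towards `G02ModulusConvergence` (`…Defs.lean`). Transposition of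
the tree's `SquareTiling.exists_forall_one_sub_le` ([GP19] Lemma 4.8, proved there with the weak
discrete Beurling estimate `le_add_rpow_of_noCircuit`, Smirnov 2010 Lemma B.2, and the no-circuit
lemma — here `walkWinding_eq_zero_of_mem_exterior'` of `…G02NoCircuit.lean`) to
`Ω_δ = discreteDomainGraph Ω δ` with the discrete arcs `discreteArc`:

* `exists_forall_one_sub_le'`: near an interior point `q` of the arc `A = R.arc i`, every
  potential `h : ℤ² → [0,1]` with `h ≡ 1` on `discreteArc Ω δ A`, harmonic for `Ω_δ` off the
  discrete arcs of `A` and `A'`, satisfies `h ≥ 1 - ε` at the interior vertices of `Ω_δ` with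
  mesh point in `B(q, r)`, for all meshes `δ < δ₀`.
-/

noncomputable section

namespace Summit.CriticalPhenomena.CardyFormulaZ2.Theorems

namespace KirchhoffSlope

open Set Metric Filter Topology
open Literature.Probability Literature.Probability.LatticeModels Literature.Probability.LatticeModels.SquareTiling
open Literature.Probability.RandomPlanarGeometry

variable {Ω : Set ℂ} {δ : ℝ}

/-! ### Boundary values near interior points of the Dirichlet arcs -/

open WeakBeurling Classical in
/-- **Boundary values of the potential of `Ω_δ` near an interior point of a Dirichlet arc**
([GP19], Lemma 4.8, for the `meshDomain`/`discreteArc` discretisation; quantitatively, by the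
weak discrete Beurling estimate of the tree, Smirnov 2010 Lemma B.2/B.3, applied to `1 - h` on
the interior vertices of `Ω_δ`). Let `R` be a conformal rectangle, `q = R.boundary t` an interior
point of the arc `A = R.arc i`, and `ε > 0`. Then there are `r > 0` and `δ₀ > 0`
such that for every mesh `δ < δ₀` and every `h : ℤ² → [0, 1]` which is `1` on `discreteArc Ω δ A`
and harmonic for `Ω_δ` off the discrete arcs of `A` and `A'`, we have `h(x) ≥ 1 - ε` at every
interior vertex `x` of `Ω_δ` whose mesh point lies in `B(q, r)`.
[cite: GeorgakopoulosPanagiotis2019, Lemma 4.8] -/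
theorem exists_forall_one_sub_le' (R : ConformalRectangle) (i : Fin 4) {t : ℝ}
    (ht : t ∈ Ioo (R.mark i) (R.nextMark i)) (A' : Set ℂ) {ε : ℝ} (hε : 0 < ε) :
    ∃ r > 0, ∃ δ₀ > 0, ∀ δ, 0 < δ → δ < δ₀ → ∀ h : Site 2 → ℝ,
      (discreteArc R.carrier δ (R.arc i)).EqOn h 1 → (∀ x, h x ∈ Icc (0 : ℝ) 1) →
      (∀ x, x ∉ discreteArc R.carrier δ (R.arc i) → x ∉ discreteArc R.carrier δ A' →
        ∑ y ∈ ((zdGraph 2).neighborFinset x).filter (fun y => (discreteDomainGraph R.carrier δ).Adj x y),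
          (h y - h x) = 0) →
      ∀ x : Site 2, meshPoint δ x ∈ ball (R.boundary t) r →
        (∀ k : Fin 4, (discreteDomainGraph R.carrier δ).Adj x (x + cornerUnit k)) → 1 - ε ≤ h x := by
  -- `∂Ω ∖ arc i ≠ ∅`: an interior point of the next arc
  have hne : (frontier R.carrier \ R.arc i).Nonempty := by
    have hlt := R.mark_lt_nextMark (i + 1)
    have hii : i ≠ i + 1 := by fin_cases i <;> decide
    exact ⟨R.boundary ((R.mark (i + 1) + R.nextMark (i + 1)) / 2), R.boundary_mem_frontier _,
      R.boundary_not_mem_arc hii ⟨by linarith, by linarith⟩⟩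
  set Ω := R.carrier with hΩdef
  set q := R.boundary t with hq
  -- the neighbourhood of `q` seeing only the arc `i`
  obtain ⟨rA, hrA, hrA1, hrA2⟩ := R.exists_pos_forall_mem_arc_of_dist_lt i ht
  have hqf : q ∈ frontier Ω := R.arc_subset_frontier i (mem_image_of_mem _ (Ioo_subset_Icc_self ht))
  -- Beurling constants and the smallness parameter `θ`
  set C := beurlingConst with hC
  set β := beurlingExp with hβ
  have hC0 : 0 < C := beurlingConst_pos
  have hβ0 : 0 < β := beurlingExp_pos
  set s₀ : ℝ := min 1 ((ε / (2 * C)) ^ β⁻¹) with hs₀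
  have hs₀pos : 0 < s₀ := lt_min one_pos (Real.rpow_pos_of_pos (by positivity) _)
  have hs₀le : C * s₀ ^ β < ε := by
    by_cases hcase : (ε / (2 * C)) ^ β⁻¹ ≤ 1
    · have : s₀ = (ε / (2 * C)) ^ β⁻¹ := min_eq_right hcase
      rw [this, Real.rpow_inv_rpow (by positivity) hβ0.ne']
      have : C * (ε / (2 * C)) = ε / 2 := by field_simp
      linarith
    · have hs1 : s₀ = 1 := min_eq_left (not_le.1 hcase).le
      rw [hs1, Real.one_rpow, mul_one]
      by_contra hle
      have h1 : ε / (2 * C) ≤ 1 := by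
        rw [div_le_one (by positivity)]; linarith [not_lt.1 hle]
      exact hcase (Real.rpow_le_one (by positivity) h1 (by positivity))
  set θ : ℝ := s₀ / 64 with hθ
  have hθpos : 0 < θ := by positivity
  have hθle : θ ≤ 1 / 64 := by
    have : s₀ ≤ 1 := min_le_left _ _
    rw [hθ]; linarith
  -- the radii
  refine ⟨θ * rA, by positivity, θ * rA, by positivity, fun δ hδ hδlt h hA h01 hharm x hx hxint => ?_⟩
  set r := θ * rA with hr
  have hrle : r ≤ rA / 64 := by rw [hr]; nlinarith
  have hδle : δ ≤ rA / 64 := hδlt.le.trans hrle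
  -- an exterior point near `q` and its coarse face `p`
  obtain ⟨e₀, he₀, hed⟩ := Metric.mem_closure_iff.1 (R.frontier_subset_closure_exterior' hqf) r
    (by positivity)
  set p : Site 2 := ![⌊e₀.re / δ⌋, ⌊e₀.im / δ⌋] with hp
  have hp0 : |δ * (p 0 : ℝ) - e₀.re| ≤ δ := by
    have e : p 0 = ⌊e₀.re / δ⌋ := rfl
    rw [e]
    have h1 := Int.floor_le (e₀.re / δ)
    have h2 := Int.lt_floor_add_one (e₀.re / δ)
    have : δ * (e₀.re / δ) = e₀.re := by field_simp
    rw [abs_le]; constructor <;> nlinarith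
  have hp1 : |δ * (p 1 : ℝ) - e₀.im| ≤ δ := by
    have e : p 1 = ⌊e₀.im / δ⌋ := rfl
    rw [e]
    have h1 := Int.floor_le (e₀.im / δ)
    have h2 := Int.lt_floor_add_one (e₀.im / δ)
    have : δ * (e₀.im / δ) = e₀.im := by field_simp
    rw [abs_le]; constructor <;> nlinarith
  -- radii in lattice units
  set Rb : ℕ := ⌊rA / (8 * δ)⌋₊ with hRb
  have hRb1 : rA / (8 * δ) - 1 < Rb := Nat.sub_one_lt_floor _
  have hRb2 : (Rb : ℝ) ≤ rA / (8 * δ) := Nat.floor_le (by positivity)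
  set ρ : ℕ := ⌊2 * r / δ⌋₊ + 1 with hρ
  -- the interior vertex set `S`
  set S : Set (Site 2) := {y ∈ meshDomain Ω δ | ∀ k : Fin 4, (discreteDomainGraph Ω δ).Adj y (y + cornerUnit k)}
    with hS
  have hSfin : S.Finite := (meshDomain_finite R.isBounded hδ).subset fun y hy => hy.1
  set g : Site 2 → ℝ := fun y => 1 - h y with hg
  -- `g` is harmonic on `S`
  have hgharm : IsLatticeSubharmonicOn g S := by
    intro y hy
    have hh := latticeLaplacian_eq_zero_of_forall_adj (A := R.arc i) (B := A') hharm hy.2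
    have : g = (fun _ => (1 : ℝ)) - h := by funext y; simp [hg]
    rw [this, latticeLaplacian_sub, latticeLaplacian_const, hh, sub_zero]
  -- `g ≤ 1` on the outer boundary
  have hg1 : ∀ w ∈ latticeOuterBoundary S, g w ≤ 1 := fun w _ => by
    simp only [hg]; linarith [(h01 w).1]
  -- `g ≤ 0` on the outer boundary inside the big box: those vertices are in `A_δ`
  have hdomS : ∀ w ∈ latticeOuterBoundary S, w ∈ meshDomain Ω δ ∧ w ∉ S := by
    rintro w ⟨hwS, v, hv, k, rfl⟩
    exact ⟨(discreteDomainGraph_adj_iff.1 (hv.2 k)).2.2, hwS⟩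
  have hg0 : ∀ w ∈ latticeOuterBoundary S, w ∈ sqBox p Rb → g w ≤ 0 := by
    intro w hw hwbox
    obtain ⟨hwD, hwS⟩ := hdomS w hw
    -- a missing edge at `w`, meeting `∂Ω` at a point `f`
    have : ¬ ∀ k : Fin 4, (discreteDomainGraph Ω δ).Adj w (w + cornerUnit k) := fun hall => hwS ⟨hwD, hall⟩
    push Not at this
    obtain ⟨k, hk⟩ := this
    obtain ⟨f, hf, hff⟩ := exists_mem_frontier_of_not_discreteDomainGraph_adj R.toJordanDomain hwD
      (cSrc_mem_edgeSet (w, k)) hk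
    -- `f` is within `rA` of `q`, hence on the arc `i`
    have hfw : dist f (meshPoint δ w) ≤ δ := by
      have hsub : segment ℝ (meshPoint δ w) (meshPoint δ (w + cornerUnit k)) ⊆ closedBall (meshPoint δ w) |δ| :=
        (convex_closedBall _ _).segment_subset (mem_closedBall_self (abs_nonneg δ))
          (by rw [mem_closedBall, _root_.dist_comm, Percolation.dist_meshPoint_of_adj (cSrc_mem_edgeSet (w, k))])
      have := hsub hf
      rwa [mem_closedBall, abs_of_pos hδ] at this
    have hwe : dist (meshPoint δ w) e₀ ≤ 2 * δ * (Rb + 1) := by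
      rw [Complex.dist_eq]
      refine (Complex.norm_le_abs_re_add_abs_im _).trans ?_
      obtain ⟨hb0, hb1⟩ := mem_sqBox.1 hwbox
      simp only [Complex.sub_re, Complex.sub_im, meshPoint_re, meshPoint_im]
      have hb0' : |((w 0 : ℝ)) - (p 0 : ℝ)| ≤ Rb := by
        rw [← Int.cast_sub, ← Int.cast_abs]; exact_mod_cast hb0
      have hb1' : |((w 1 : ℝ)) - (p 1 : ℝ)| ≤ Rb := by
        rw [← Int.cast_sub, ← Int.cast_abs]; exact_mod_cast hb1
      have e0 : δ * (w 0 : ℝ) - e₀.re = δ * ((w 0 : ℝ) - p 0) + (δ * (p 0 : ℝ) - e₀.re) := by ring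
      have e1 : δ * (w 1 : ℝ) - e₀.im = δ * ((w 1 : ℝ) - p 1) + (δ * (p 1 : ℝ) - e₀.im) := by ring
      rw [e0, e1]
      have a0 : |δ * ((w 0 : ℝ) - p 0)| ≤ δ * Rb := by rw [abs_mul, abs_of_pos hδ]; gcongr
      have a1 : |δ * ((w 1 : ℝ) - p 1)| ≤ δ * Rb := by rw [abs_mul, abs_of_pos hδ]; gcongr
      calc |δ * ((w 0 : ℝ) - p 0) + (δ * (p 0 : ℝ) - e₀.re)| + |δ * ((w 1 : ℝ) - p 1) + (δ * (p 1 : ℝ) - e₀.im)|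
          ≤ (|δ * ((w 0 : ℝ) - p 0)| + |δ * (p 0 : ℝ) - e₀.re|) + (|δ * ((w 1 : ℝ) - p 1)| + |δ * (p 1 : ℝ) - e₀.im|) :=
            add_le_add (abs_add_le _ _) (abs_add_le _ _)
        _ ≤ (δ * Rb + δ) + (δ * Rb + δ) := by gcongr
        _ = 2 * δ * (Rb + 1) := by ring
    have hRδ : 2 * δ * (Rb + 1) ≤ rA / 4 + 2 * δ := by
      have h1 := mul_le_mul_of_nonneg_left hRb2 (by positivity : (0 : ℝ) ≤ 2 * δ)
      rw [show 2 * δ * (rA / (8 * δ)) = rA / 4 by field_simp; ring] at h1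
      linarith
    have hwq : dist (meshPoint δ w) q ≤ rA / 4 + 2 * δ + r := by
      calc dist (meshPoint δ w) q ≤ dist (meshPoint δ w) e₀ + dist e₀ q := dist_triangle _ _ _
        _ ≤ (rA / 4 + 2 * δ) + r := by
            gcongr
            · exact hwe.trans hRδ
            · rw [_root_.dist_comm]; exact hed.le
    have hfq : dist f q < rA := by
      calc dist f q ≤ dist f (meshPoint δ w) + dist (meshPoint δ w) q := dist_triangle _ _ _
        _ ≤ δ + (rA / 4 + 2 * δ + r) := add_le_add hfw hwq
        _ < rA := by linarith
    have hfA : f ∈ R.arc i := hrA1 f hff hfq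
    -- hence `w ∈ discreteArc Ω δ (R.arc i)`
    have hwb : w ∈ meshBoundary Ω δ := ⟨hwD, _, cSrc_mem_edgeSet (w, k), hk⟩
    have hwA : w ∈ discreteArc Ω δ (R.arc i) := by
      refine ⟨hwb, ?_⟩
      have hle : infDist (meshPoint δ w) (R.arc i) ≤ δ :=
        (infDist_le_dist_of_mem hfA).trans (by rw [_root_.dist_comm]; exact hfw)
      refine hle.trans ((le_infDist hne).2 fun z hz => ?_)
      -- `z ∈ ∂Ω ∖ arc i` lies on another arc, at distance `≥ rA` from `q`
      have hz' : z ∈ ⋃ j, R.arc j := by rw [R.iUnion_arc_holds]; exact hz.1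
      obtain ⟨j, hj⟩ := mem_iUnion.1 hz'
      have hji : j ≠ i := fun hji => hz.2 (hji ▸ hj)
      have hzq : rA ≤ dist z q := hrA2 j hji z hj
      have := dist_triangle z (meshPoint δ w) q
      rw [_root_.dist_comm z (meshPoint δ w)] at this
      linarith
    have := hA hwA
    simp only [hg, Pi.one_apply] at this ⊢
    linarith
  -- no circuits of `S` around the exterior face `p`
  have hW : ∀ (c : Site 2) (W : (zdGraph 2).Walk c c), (∀ z ∈ W.support, z ∈ S ∧ z ∈ sqBox p Rb) →
      Percolation.walkWinding W p = 0 := by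
    intro c W hWs
    refine walkWinding_eq_zero_of_mem_exterior' R.isBounded R.isConnected_exterior hδ
      he₀ W fun dw hdw => ?_
    have hu : dw.fst ∈ S := (hWs _ (W.dart_fst_mem_support_of_mem_darts hdw)).1
    obtain ⟨k, hk⟩ := WeakBeurling.exists_eq_add_cornerUnit_of_adj dw.adj
    have := hu.2 k
    rw [← hk] at this
    exact (discreteDomainGraph_adj_iff.1 this).1
  -- `x ∈ S` and `x ∈ sqBox p ρ`
  have hxD : x ∈ meshDomain Ω δ := (discreteDomainGraph_adj_iff.1 (hxint 0)).2.1
  have hxS : x ∈ S := ⟨hxD, hxint⟩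
  have hxbox : x ∈ sqBox p ρ := by
    have hxq : dist (meshPoint δ x) q < r := mem_ball.1 hx
    have hxe : dist (meshPoint δ x) e₀ < 2 * r := by
      calc dist (meshPoint δ x) e₀ ≤ dist (meshPoint δ x) q + dist q e₀ := dist_triangle _ _ _
        _ < r + r := add_lt_add hxq hed
        _ = 2 * r := by ring
    rw [Complex.dist_eq] at hxe
    have hre := (Complex.abs_re_le_norm (meshPoint δ x - e₀)).trans_lt hxe
    have him := (Complex.abs_im_le_norm (meshPoint δ x - e₀)).trans_lt hxe
    simp only [Complex.sub_re, Complex.sub_im, meshPoint_re, meshPoint_im] at hre him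
    have hρ' : 2 * r / δ < (ρ : ℝ) := by
      rw [hρ]; push_cast; linarith [Nat.lt_floor_add_one (2 * r / δ)]
    have key : ∀ (a b : ℤ) (u : ℝ), |δ * (a : ℝ) - u| < 2 * r → |δ * (b : ℝ) - u| ≤ δ → |a - b| ≤ (ρ : ℤ) := by
      intro a b u ha hb
      have h1 : |δ * ((a : ℝ) - b)| < 2 * r + δ := by
        calc |δ * ((a : ℝ) - b)| = |(δ * (a : ℝ) - u) - (δ * (b : ℝ) - u)| := by ring_nf
          _ ≤ |δ * (a : ℝ) - u| + |δ * (b : ℝ) - u| := abs_sub _ _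
          _ < 2 * r + δ := by linarith
      rw [abs_mul, abs_of_pos hδ] at h1
      have h2 : |((a : ℝ) - b)| < 2 * r / δ + 1 := by
        rw [div_add_one hδ.ne', lt_div_iff₀ hδ]; linarith
      have h3 : |((a - b : ℤ) : ℝ)| < (ρ : ℝ) + 1 := by push_cast; linarith
      have h4 : |a - b| < (ρ : ℤ) + 1 := by
        rw [← Int.cast_abs] at h3; exact_mod_cast h3
      omega
    rw [mem_sqBox]
    exact ⟨key _ _ _ hre hp0, key _ _ _ him hp1⟩
  -- the Beurling estimate
  have hB := le_add_rpow_of_noCircuit hSfin hgharm hg1 (p := p) (R := Rb) (η := 0) le_rfl hg0 hW hxS hxbox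
  rw [zero_add] at hB
  -- the ratio `(ρ + 1)/(Rb + 1) ≤ 64 θ = s₀`
  have hratio : ((ρ : ℝ) + 1) / ((Rb : ℝ) + 1) ≤ s₀ := by
    have hnum : (ρ : ℝ) + 1 ≤ 2 * r / δ + 2 := by
      rw [hρ]; push_cast; linarith [Nat.floor_le (show 0 ≤ 2 * r / δ by positivity)]
    have hden : rA / (8 * δ) ≤ (Rb : ℝ) + 1 := by linarith
    have hden0 : 0 < rA / (8 * δ) := by positivity
    calc ((ρ : ℝ) + 1) / ((Rb : ℝ) + 1) ≤ (2 * r / δ + 2) / (rA / (8 * δ)) := by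
          gcongr
        _ = (16 * r + 16 * δ) / rA := by field_simp; ring
        _ ≤ (16 * r + 16 * r) / rA := by gcongr
        _ = 32 * θ := by rw [hr]; field_simp; ring
        _ ≤ s₀ := by rw [hθ]; linarith
  have hpow : C * (((ρ : ℝ) + 1) / ((Rb : ℝ) + 1)) ^ β ≤ C * s₀ ^ β := by
    gcongr
  have : g x < ε := (hB.trans hpow).trans_lt hs₀le
  simp only [hg] at this
  linarith

end KirchhoffSlope

end Summit.CriticalPhenomena.CardyFormulaZ2.Theorems
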